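import Literature.MathematicalPhysics.QuantumFieldTheory.Balaban1983to89.Beta.RemainderKernelNeumann

/-!
# [Balaban1985Variational] Sect. G (184) ON THE TORI: the torus equation `(I + G̃W)𝔄₀ = G̃Δ⁽²⁾H₀ − G̃WH₀` with periodised
# primitive operators has EXACTLY ONE solution, the periodisation of the `ℤ^d` solution — the model road's entry-shape
# letter `hA0` DERIVED from (184) as printed, per volume (`Beta.RemainderKernelNeumannTorus`)

statement-level skeleton of published theorems with citation tags; proofs where landed; nothing here is a claim
about the Yang–Mills mass gap.

HONEST FRAMING (cell rule).  Bookkeeping for the k-uniform remainder chain of row (D4) (`RemainderConst` ⇐ ONE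
`ChainTFac190` instance, `Beta.RemainderDecay190`); discharges NOTHING of `BetaPertH`; NOT B12 Thm 2, NOT the continuum
limit, NOT Clay.  Unit `b2b-balaban-beta-an4` gen 97 (BINDER row D4 OWNER; cell pub-balaban).  Imports
`Beta.RemainderKernelNeumann` (gen 97; carrying gen 95's `RemainderKernelPeriodised`: `entry_add` ∕ `entry_comp` ∕
`isPeriodic₂_compKer`, and gen 9's `EntrywiseVolumeLimit`: `periodise₂`, `periodise₂_add`, `periodise₂_compKer`,
`RowBound`, `tsum_eq_sum_tsum_imageShift`) ONLY; nothing edited.  [folklore] linear algebra on the torus fields.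

WHY.  In print (184) is an equation PER VOLUME: for the k-th step on the torus `T`, the operator `𝔄₀ = (δ∕δB)𝒜₀` solves
`(I + G̃W)𝔄₀ = G̃Δ⁽²⁾H₀ − G̃WH₀` with THAT torus's `G̃`, `W`, `Δ⁽²⁾H₀`, `H₀` ([15] p. 307).  The model road
(`RemainderDecay190SupNormPieces` … `RemainderDecay190PrimitiveEnd`) reads the torus operators as periodisations of `ℤ^d`
pieces — for `𝔄₀` the letter `hA0 : 𝔄₀(δ_b) a = â₀(a, b)` with `a₀` the `ℤ^d` solution of (184)
(`RemainderKernelNeumann.decay₂_of_eq184`, `RemainderKernelNeumannExistence.exists_eq184`).  THIS FILE proves that letter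
from the TORUS equation: if the four primitive torus operators act entrywise as the periodisations of decaying,
block-periodic `ℤ^d` pieces `g̃, w, Δ⁽²⁾h₀, h₀` and a torus operator `𝔄₀` satisfies `B11SectG.Eq184` with them, then
`𝔄₀(δ_b) a = â₀(a, b)` where `a₀` is ANY bounded block-periodic `ℤ^d` solution of the kernel identity (184) — because
(§2) the periodisation of a `ℤ^d` solution solves the torus equation (`periodise₂_compKer`, the block-periodic Lemma
2.2.2 product rule) and (§1) the torus equation has at most one solution once the torus row sums of `|(G̃W)^|` are `< 1`
(§3: they are bounded by the `ℤ^d` row bound `θ_K·K₁(δ_K)` — the smallness (187) again).  So the builder who holds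
Bałaban's torus operators with the torus identity (184), as printed, obtains the model road's `hA0` with no further
letter.

WHAT.  §1 `torus_fix_unique` (ℓ^∞ uniqueness on a finite torus: `u(a,b) + Σ_c K(a,c)u(c,b) = 0`, `Σ_c |K(a,c)| ≤ q < 1`
⟹ `u = 0`); §2 `sum_abs_periodise₂_le` (torus row sums of `|K̂|` ≤ the `ℤ^d` row bound), `periodise₂_fix` (the
periodised `ℤ^d` solution solves the torus equation); §3 `apply_eq_sum_mul_single` (a torus linear map in the site basis),
**`entry_eq184`** — `Eq184 A0 H0 Gt W D2H0` on the torus + entry shapes of `Gt, W, D2H0, H0` from decaying block-periodic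
pieces + a bounded block-periodic `ℤ^d` solution `a₀` of (184) + `θ_K·K₁(δ_K) < 1` ⟹ `A0(δ_b) a = â₀(a, b)`.
WHAT IS *NOT* DONE: nothing of Bałaban's operators is constructed (NODE O); (189) NOT proved; row D4 class UNCHANGED
(instance 0∕1; critical-path width 0 = NODE O; D4 DISCHARGE NO DATE).  No `def`, no named fact, no `sorry`, standard
axioms.
HONEST DEPENDENCY: continuum YM on T⁴ ⇐ BetaPertH ∧ nine spine estimates (0/9 proved); BetaPertH ⇐ (D1) ∧ (D4) ∧
CAP+tail; G-an2-4 gates asym, D1 and NE2/3/4.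

Sources: [15] = T. Bałaban, Commun. Math. Phys. **102** (1985) 277–309 [Balaban1985Variational], (183)–(184) p. 307,
(187)–(188) p. 308; [Balaban1984PropagatorsI] T. Bałaban, Commun. Math. Phys. **95** (1984) 17–40, p. 36 (torus operators
as periodisations); [Slade2017] Lemma 2.2.2 (the product rule, via `EntrywiseVolumeLimit.periodise₂_compKer`).
-/

namespace Literature.MathematicalPhysics.QuantumFieldTheory.Balaban1983to89.Beta.RemainderKernelNeumannTorus

open Literature.MathematicalPhysics.QuantumFieldTheory.Balaban1983to89
open Literature.MathematicalPhysics.QuantumFieldTheory.Balaban1983to89.B12Sec2to5 (l1 l1_nonneg summable_exp_neg_l1)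
open Literature.MathematicalPhysics.QuantumFieldTheory.Balaban1983to89.B12Decay510Window (K₁ K₁_nonneg)
open Literature.MathematicalPhysics.QuantumFieldTheory.Balaban1983to89.TreeLengthTorus (TPt)
open Literature.MathematicalPhysics.QuantumFieldTheory.Balaban1983to89.B11SectG (Eq184)
open Literature.MathematicalPhysics.QuantumFieldTheory.Balaban1983to89.Beta
  (Kernel₂ Decay₂ IsPeriodic₂ RowBound compKer periodise₂ periodise₂_add periodise₂_compKer imageShift windowMap
    tsum_eq_sum_tsum_imageShift imageShift_injective)
open Literature.MathematicalPhysics.QuantumFieldTheory.Balaban1983to89.Beta.RemainderKernelPeriodised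
  (isPeriodic₂_compKer entry_comp)
open Literature.MathematicalPhysics.QuantumFieldTheory.Balaban1983to89.Beta.RemainderKernelNeumann
  (decay₂_compKer_left decay₂_sub)

variable {d : ℕ}

/-! ## §1. ℓ^∞ uniqueness on a finite torus -/

/-- **UNIQUENESS ON THE TORUS.**  On a finite index type, if `u(a,b) + Σ_c K(a,c)·u(c,b) = 0` for all `a, b` and every row
of `|K|` sums to at most `q < 1`, then `u = 0` (look at a maximal `|u(·,b)|`). — the torus form of *"the norm of the
linear operator is small"* (187). [cite: Balaban1985Variational, (187)–(188) p.308] -/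
theorem torus_fix_unique {ι : Type*} [Fintype ι] {K u : ι → ι → ℝ} {q : ℝ} (hq : q < 1)
    (hK : ∀ a, ∑ c, |K a c| ≤ q) (hu : ∀ a b, u a b + ∑ c, K a c * u c b = 0) : ∀ a b, u a b = 0 := by
  classical
  intro a₀ b
  by_cases hne : (Finset.univ : Finset ι).Nonempty
  swap
  · exact absurd ⟨a₀, Finset.mem_univ _⟩ hne
  obtain ⟨a, _, hmax⟩ := Finset.exists_max_image Finset.univ (fun a => |u a b|) hne
  have hm : ∀ c, |u c b| ≤ |u a b| := fun c => hmax c (Finset.mem_univ c)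
  have hq0 : 0 ≤ q := le_trans (Finset.sum_nonneg fun c _ => abs_nonneg (K a c)) (hK a)
  have h1 : |u a b| ≤ q * |u a b| := by
    have e : u a b = -∑ c, K a c * u c b := by linarith [hu a b]
    calc |u a b| = |∑ c, K a c * u c b| := by rw [e, abs_neg]
      _ ≤ ∑ c, |K a c * u c b| := Finset.abs_sum_le_sum_abs _ _
      _ ≤ ∑ c, |K a c| * |u a b| := Finset.sum_le_sum fun c _ => by
          rw [abs_mul]; exact mul_le_mul_of_nonneg_left (hm c) (abs_nonneg _)
      _ = (∑ c, |K a c|) * |u a b| := by rw [Finset.sum_mul]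
      _ ≤ q * |u a b| := mul_le_mul_of_nonneg_right (hK a) (abs_nonneg _)
  have h2 : |u a b| = 0 := by nlinarith [abs_nonneg (u a b)]
  have h3 : |u a₀ b| ≤ 0 := h2 ▸ hm a₀
  exact abs_nonpos_iff.mp h3

/-! ## §2. Periodisation: torus row sums, and the periodised `ℤ^d` solution solves the torus equation -/

section Torus

variable {s : ℕ} [NeZero s]

/-- The torus row sums of `|K̂|` are bounded by the `ℤ^d` row bound of `K`: `Σ_c |K̂(a,c)| ≤ B` — the classes modulo
`s·ℤ^d` partition `ℤ^d`. [cite: Balaban1984PropagatorsI, p.36] -/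
theorem sum_abs_periodise₂_le {K : Kernel₂ d} {B : ℝ} (hK : RowBound K B) (a : TPt d s) :
    ∑ c : TPt d s, |periodise₂ s K a c| ≤ B := by
  have hrow := (hK (windowMap d s a)).1
  have hsplit := tsum_eq_sum_tsum_imageShift (s := s) hrow
  calc ∑ c : TPt d s, |periodise₂ s K a c|
      ≤ ∑ c : TPt d s, ∑' m : Fin d → ℤ, |K (windowMap d s a) (imageShift s (windowMap d s c) m)| := by
        refine Finset.sum_le_sum fun c _ => ?_
        show |∑' m : Fin d → ℤ, K (windowMap d s a) (imageShift s (windowMap d s c) m)| ≤ _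
        have hsm : Summable fun m : Fin d → ℤ => |K (windowMap d s a) (imageShift s (windowMap d s c) m)| :=
          hrow.comp_injective (imageShift_injective s _)
        have h := norm_tsum_le_tsum_norm (f := fun m : Fin d → ℤ =>
          K (windowMap d s a) (imageShift s (windowMap d s c) m)) (by simpa only [Real.norm_eq_abs] using hsm)
        simpa only [Real.norm_eq_abs] using h
    _ = ∑' y, |K (windowMap d s a) y| := hsplit.symm
    _ ≤ B := (hK _).2

/-- **THE PERIODISED `ℤ^d` SOLUTION SOLVES THE TORUS EQUATION.**  If `a + k∘a = σ` entrywise on `ℤ^d` with `k` decaying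
(`δ > 0`), `a` block-periodic and row-bounded and `σ` with summable rows, then on the torus with `s` sites per direction
`â(x,y) + Σ_c k̂(x,c)·â(c,y) = σ̂(x,y)` — `periodise₂_add` + the product rule `periodise₂_compKer`.
[cite: Balaban1985Variational, (184) p.307; Slade2017, Lemma 2.2.2] -/
theorem periodise₂_fix {k a σ : Kernel₂ d} {θ δ B : ℝ} (hk : Decay₂ k θ δ) (hδ : 0 < δ)
    (pa : IsPeriodic₂ s a) (ra : RowBound a B) (hσ : ∀ x, Summable (σ x))
    (hfix : ∀ x y, a x y + compKer k a x y = σ x y) (x y : TPt d s) :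
    periodise₂ s a x y + ∑ c : TPt d s, periodise₂ s k x c * periodise₂ s a c y = periodise₂ s σ x y := by
  have hk1 : ∀ x, Summable fun y => |k x y| := (hk.rowBound hδ).summable_abs
  have e : σ = a + compKer k a := by
    funext x y; rw [Pi.add_apply, Pi.add_apply]; exact (hfix x y).symm
  have hc : ∀ x, Summable (compKer k a x) := fun x => by
    have e' : compKer k a x = fun y => σ x y - a x y := by
      funext y; have := hfix x y; linarith
    rw [e']
    exact (hσ x).sub (ra.summable x)
  rw [e, periodise₂_add ra.summable hc, periodise₂_compKer hk1 pa ra]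

end Torus

/-! ## §3. (184) on the torus has exactly the periodised `ℤ^d` solution -/

section Entry

variable {s : ℕ} [NeZero s]

/-- A linear map on the torus fields read in the site basis, coefficients first: `A v a = Σ_b v b · A(δ_b) a`.
[cite: Balaban1984PropagatorsI, p.36] -/
theorem apply_eq_sum_mul_single (A : (TPt d s → ℝ) →ₗ[ℝ] (TPt d s → ℝ)) (v : TPt d s → ℝ) (a : TPt d s) :
    A v a = ∑ b, v b * A (Pi.single b 1) a := by
  classical
  conv_lhs => rw [← Finset.univ_sum_single v]
  rw [map_sum, Finset.sum_apply]
  refine Finset.sum_congr rfl fun b _ => ?_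
  have e : (Pi.single b (v b) : TPt d s → ℝ) = v b • (Pi.single b (1 : ℝ) : TPt d s → ℝ) := by
    rw [← Pi.single_smul', smul_eq_mul, mul_one]
  rw [e, map_smul, Pi.smul_apply, smul_eq_mul]

/-- **(184) ON THE TORUS DETERMINES 𝔄₀'S ENTRIES: they are the periodisation of the `ℤ^d` solution.**  Torus operators
`A0 H0 Gt W D2H0` on the sup-model carrier (`TPt d s → ℝ`) with `B11SectG.Eq184 A0 H0 Gt W D2H0`
(*"(I + G̃((δ²∕δA′²)V)(𝒜₀ + H₀B))𝔄₀ = G̃Δ⁽²⁾H₀ − G̃((δ²∕δA′²)V)(𝒜₀ + H₀B)H₀"*, per volume); `Gt, W, D2H0, H0` acting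
entrywise as the periodisations of `ℤ^d` pieces `g̃` (B_G, δ₀), `w` (θ_W, ¼δ₀) = (189), `Δ⁽²⁾h₀` (c_Δ, δ₀), `h₀` (A₀,
δ₀), `δ₀ > 0`, all four block-periodic under `s`; `a₀` ANY bounded `ℤ^d` kernel with the kernel identity (184) (its
decay and block-periodicity follow: `RemainderKernelNeumann.decay₂_of_eq184` ∕ `isPeriodic₂_of_eq184`); smallness
`B_Gθ_W·K₁(δ₀ − ¼δ₀)·K₁(¼δ₀ − ⅛δ₀) < 1` ((187)).  THEN `A0(δ_b) a = â₀(a, b)` for all `a, b` — the model road's letter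
`hA0`, from (184) AS PRINTED (per torus).  Proof: both `(a,b) ↦ A0(δ_b) a` (site-basis reading of `Eq184`, the entries
of `G̃W`, `G̃Δ⁽²⁾H₀`, `G̃WH₀` being periodisations by `RemainderKernelPeriodised.entry_comp`) and `â₀` (`periodise₂_fix`)
solve the torus equation, whose kernel `(G̃W)^` has torus row sums `≤ B_Gθ_WK₁(δ₀−¼δ₀)·K₁(¼δ₀) < 1`
(`sum_abs_periodise₂_le`); `torus_fix_unique`.
[cite: Balaban1985Variational, (183)–(184) p.307, (187)–(188) p.308; Balaban1984PropagatorsI, p.36] -/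
theorem entry_eq184 {A0 H0 Gt W D2H0 : (TPt d s → ℝ) →ₗ[ℝ] (TPt d s → ℝ)}
    {gt w d2h0 h0 a0 : Kernel₂ d} {BG θW cΔ A₀ M₀ δ₀ : ℝ}
    (h184 : Eq184 A0 H0 Gt W D2H0)
    (hGt : ∀ a b, Gt (Pi.single b 1) a = periodise₂ s gt a b)
    (hW : ∀ a b, W (Pi.single b 1) a = periodise₂ s w a b)
    (hD2 : ∀ a b, D2H0 (Pi.single b 1) a = periodise₂ s d2h0 a b)
    (hH0 : ∀ a b, H0 (Pi.single b 1) a = periodise₂ s h0 a b)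
    (hgt : Decay₂ gt BG δ₀) (hw : Decay₂ w θW (δ₀ / 4)) (hd2 : Decay₂ d2h0 cΔ δ₀) (hh0 : Decay₂ h0 A₀ δ₀)
    (hδ₀ : 0 < δ₀) (pgt : IsPeriodic₂ s gt) (pw : IsPeriodic₂ s w) (pd2 : IsPeriodic₂ s d2h0) (ph0 : IsPeriodic₂ s h0)
    (hM₀ : ∀ x y, |a0 x y| ≤ M₀)
    (ha184 : ∀ x y, a0 x y + compKer (compKer gt w) a0 x y = compKer gt d2h0 x y - compKer (compKer gt w) h0 x y)
    (hq : BG * θW * K₁ d (δ₀ - δ₀ / 4) * K₁ d (δ₀ / 4 - δ₀ / 8) < 1) :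
    ∀ a b, A0 (Pi.single b 1) a = periodise₂ s a0 a b := by
  classical
  have hBG : 0 ≤ BG := hgt.constant_nonneg
  have hθW : 0 ≤ θW := hw.constant_nonneg
  -- the weaker smallness at K₁(¼δ₀)
  have hq4 : BG * θW * K₁ d (δ₀ - δ₀ / 4) * K₁ d (δ₀ / 4) < 1 :=
    lt_of_le_of_lt (mul_le_mul_of_nonneg_left (RemainderKernelNeumann.K₁_anti (by linarith) (by linarith))
      (mul_nonneg (mul_nonneg hBG hθW) (K₁_nonneg _ _))) hq
  -- the ℤ^d kernel K = g̃∘w: decay, rows, periodicity, torus entries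
  have hK : Decay₂ (compKer gt w) (BG * θW * K₁ d (δ₀ - δ₀ / 4)) (δ₀ / 4) :=
    decay₂_compKer_left hgt hw (by linarith) (by linarith) le_rfl
  have hKrow : RowBound (compKer gt w) (BG * θW * K₁ d (δ₀ - δ₀ / 4) * K₁ d (δ₀ / 4)) :=
    hK.rowBound (by linarith)
  have pK : IsPeriodic₂ s (compKer gt w) := isPeriodic₂_compKer pgt pw
  have hGW : ∀ a b, (Gt ∘ₗ W) (Pi.single b 1) a = periodise₂ s (compKer gt w) a b :=
    entry_comp hGt hW (hgt.rowBound hδ₀).summable_abs pw (hw.rowBound (by linarith))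
  -- torus entries of the right-hand side
  have hR1 : ∀ a b, (Gt ∘ₗ D2H0) (Pi.single b 1) a = periodise₂ s (compKer gt d2h0) a b :=
    entry_comp hGt hD2 (hgt.rowBound hδ₀).summable_abs pd2 (hd2.rowBound hδ₀)
  have hR2 : ∀ a b, ((Gt ∘ₗ W) ∘ₗ H0) (Pi.single b 1) a = periodise₂ s (compKer (compKer gt w) h0) a b :=
    entry_comp hGW hH0 hKrow.summable_abs ph0 (hh0.rowBound hδ₀)
  -- (1) the torus equation for the entries of A0
  have hT1 : ∀ a b, A0 (Pi.single b 1) a + ∑ c, periodise₂ s (compKer gt w) a c * A0 (Pi.single b 1) c =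
      periodise₂ s (compKer gt d2h0) a b - periodise₂ s (compKer (compKer gt w) h0) a b := by
    intro a b
    have h : A0 + (Gt ∘ₗ W) ∘ₗ A0 = Gt ∘ₗ D2H0 - (Gt ∘ₗ W) ∘ₗ H0 := h184
    have e := congrFun (LinearMap.congr_fun h (Pi.single b 1)) a
    have e1 : ((Gt ∘ₗ W) ∘ₗ A0) (Pi.single b 1) a = ∑ c, periodise₂ s (compKer gt w) a c * A0 (Pi.single b 1) c := by
      rw [LinearMap.comp_apply, apply_eq_sum_mul_single (Gt ∘ₗ W)]
      exact Finset.sum_congr rfl fun c _ => by rw [hGW, mul_comm]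
    rw [LinearMap.add_apply, Pi.add_apply, LinearMap.sub_apply, Pi.sub_apply, e1, hR1, hR2] at e
    exact e
  -- (2) the torus equation for the periodised ℤ^d solution
  have ha8 := RemainderKernelNeumann.decay₂_of_eq184 hgt hw hd2 hh0 hδ₀ hM₀ ha184 hq
  have pa : IsPeriodic₂ s a0 := RemainderKernelNeumann.isPeriodic₂_of_eq184 hgt hw hδ₀ pgt pw pd2 ph0 hM₀ ha184 hq4
  have ra := ha8.rowBound (by linarith : 0 < δ₀ / 8)
  have hs1 : Decay₂ (compKer gt d2h0) (BG * cΔ * K₁ d (δ₀ - δ₀ / 4)) (δ₀ / 4) :=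
    decay₂_compKer_left hgt hd2 (by linarith) (by linarith) (by linarith)
  have hs2 : Decay₂ (compKer (compKer gt w) h0) (BG * θW * K₁ d (δ₀ - δ₀ / 4) * A₀ * K₁ d (δ₀ / 4 - δ₀ / 8))
      (δ₀ / 8) := decay₂_compKer_left hK hh0 (by linarith) (by linarith) (by linarith)
  have hσ : ∀ x, Summable fun y => compKer gt d2h0 x y - compKer (compKer gt w) h0 x y := fun x =>
    (hs1.summable_row (by linarith) x).sub (hs2.summable_row (by linarith) x)
  have hT2 : ∀ a b, periodise₂ s a0 a b + ∑ c, periodise₂ s (compKer gt w) a c * periodise₂ s a0 c b =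
      periodise₂ s (compKer gt d2h0) a b - periodise₂ s (compKer (compKer gt w) h0) a b := by
    intro a b
    have h := periodise₂_fix (σ := fun x y => compKer gt d2h0 x y - compKer (compKer gt w) h0 x y)
      hK (by linarith) pa ra hσ ha184 a b
    rw [h]
    have eσ : (fun x y => compKer gt d2h0 x y - compKer (compKer gt w) h0 x y) =
        compKer gt d2h0 + fun x y => (-1 : ℝ) * compKer (compKer gt w) h0 x y := by
      funext x y; simp only [Pi.add_apply]; ring
    rw [eσ, periodise₂_add (hs1.summable_row (by linarith))
      (fun x => ((hs2.summable_row (by linarith)) x).mul_left (-1)), Beta.periodise₂_const_mul]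
    ring
  -- (3) uniqueness on the torus
  have hu := torus_fix_unique (ι := TPt d s) hq4
    (K := fun a c => periodise₂ s (compKer gt w) a c)
    (u := fun a b => A0 (Pi.single b 1) a - periodise₂ s a0 a b)
    (fun a => sum_abs_periodise₂_le hKrow a) (fun a b => by
      have e1 := hT1 a b
      have e2 := hT2 a b
      have e3 : ∑ c, periodise₂ s (compKer gt w) a c * (A0 (Pi.single b 1) c - periodise₂ s a0 c b) =
          ∑ c, periodise₂ s (compKer gt w) a c * A0 (Pi.single b 1) c -
            ∑ c, periodise₂ s (compKer gt w) a c * periodise₂ s a0 c b := by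
        rw [← Finset.sum_sub_distrib]
        exact Finset.sum_congr rfl fun c _ => by ring
      show A0 (Pi.single b 1) a - periodise₂ s a0 a b +
        ∑ c, periodise₂ s (compKer gt w) a c * (A0 (Pi.single b 1) c - periodise₂ s a0 c b) = 0
      rw [e3]
      linarith)
  intro a b
  have h := hu a b
  exact sub_eq_zero.mp h

end Entry

end Literature.MathematicalPhysics.QuantumFieldTheory.Balaban1983to89.Beta.RemainderKernelNeumannTorus
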